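import Summits.BirchSwinnertonDyer.BirchSwinnertonDyer.Theorems.PrintCf2SplitBadTwoLineLocalDefectVbarInertialMover
import Summits.BirchSwinnertonDyer.BirchSwinnertonDyer.Theorems.PrintCf2SplitBadTwoLineLocalDefectVbarFrameOdd
import HarnessLib

/-!
# Road α, crux `PrintCf2.SplitBadTwoRankOneOfFacts` (stmt-BirchSwinnertonDyer-20368), stub S3d — the local defect `Def(v̄)` on the frames with
# `d ≡ 2, 10 (mod 16)` (class (i): an INERTIAL mover) is FINITE with at most two elements

Cell `bsd-print-cf2`, width seat `bsd-line-cf2-p1-w6` g4 (S3d: «𝓗 local + ch(𝓗^∨)(0) per class»); `--supports stmt-BirchSwinnertonDyer-20368 --as helper`.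
HONEST FRAMING: nothing here closes the crux or a registered stub; no summit statement is proved by this seat; BSD is not proved by any of this. No
definition, no named fact, no `sorry`.

Frame: member `C • W = cm7^{(d)}`, `d = 2d'` with `d' ≡ 1 (mod 4)` (i.e. `d ≡ 2, 10 (mod 16)`), `K` imaginary quadratic, `2 = v v̄`, `W*` pinned at `v`, `κ'` the
`ℤ₂`-line unramified outside `v̄`.
* **`exists_inertial_mover_vbar_of_frame`** — some `τ₀ ∈ I_v̄ ∩ ker κ'` acts as `−1` on `W*`: the inertia element with `ε(τ₀) = −1`
  (`ZpExtension.exists_mem_inertia_cyclotomicCharacter_eq_of_split`) fixes `ι√2` (`ε ≡ 7 (8)`, `smul_geomSqrt_two_eq_of_cyclotomicCharacter`) and `√d'`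
  (`smul_geomSqrt_eq_of_mem_absInertia_of_emod_four_eq_one`), hence `ι√d`, so by the kernel type it acts as `s·ε = −1` on every `W*[2^k]`; it lies in
  `ker κ'` by (C3) `mem_kerSubgroup_iff_smul_of_frame`. (The mover construction of B15 file 11
  `natCard_localKer_vbar_eq_two_of_frame_of_kerC3_even_one`, exported — adapted from that proof.)
* **`finite_localDefect_vbar_of_frame_even_one`** — `Def(κ', W*, v̄)` is finite with `# ≤ 2` (p691098 `natCard_localDefect_le_two`: inertial mover, signs
  by (C3), one element of order `2`, ramification of the line at `v̄`). So on this class `𝓗` is FINITE and `e_δ = 0` (ch insensitive to finite modules).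

presearch: Rubin LNM 1716 §3 Lemma 3.6 (ii), Cor. 3.17; Agboola 2007 §3 Prop. 3.2 — held; no new fact. beyond-print theorem: no.

References: [Rubin1999] §3 Lemma 3.6 (ii), Cor. 3.17; [Agboola2007] §3 Prop. 3.2; [GreenbergLNM1716] §3; [SerreAbelianLadic1968] Ch. I §1.2.
-/

noncomputable section

open scoped Classical

set_option linter.dupNamespace false
set_option autoImplicit false

open NumberField IsDedekindDomain Field WeierstrassCurve
open Literature.NumberTheory.EllipticCurves Literature.NumberTheory.EllipticCurves.GreenbergSelmer
open Literature.NumberTheory.GaloisRepresentations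
open Summit.BirchSwinnertonDyer.BirchSwinnertonDyer.Theorems.PrintCf2.AdditiveAtSeven
open Summit.BirchSwinnertonDyer.BirchSwinnertonDyer.Theorems.PrintCf2.CMPrimes
open Summit.BirchSwinnertonDyer.BirchSwinnertonDyer.Theorems.PrintCf2.RestrictedSelmerPair
open Summit.BirchSwinnertonDyer.BirchSwinnertonDyer.Theorems.PrintCf2.SplitPrimeLine

namespace Summit.BirchSwinnertonDyer.BirchSwinnertonDyer.Theorems.PrintCf2.LineLocallyTrivial

variable {K : Type} [Field K] [NumberField K]

/-- **An INERTIAL mover on the frames with `d = 2d'`, `d' ≡ 1 (mod 4)`**: some `τ₀ ∈ I_v̄` acts as `−1` on all of `W*` and lies in `ker κ'` (adapted from B15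
file 11 `natCard_localKer_vbar_eq_two_of_frame_of_kerC3_even_one`, Steps 2–3, with (C3) discharged by `mem_kerSubgroup_iff_smul_of_frame`).
[cite: Rubin1999, §3 Lemma 3.6 (ii) and Cor. 3.17] [cite: SerreAbelianLadic1968, Ch. I §1.2] -/
theorem exists_inertial_mover_vbar_of_frame {d : ℤ} (hd0 : d ≠ 0) (h2d : (2 : ℤ) ∣ d) (hd1 : (d / 2) % 4 = 1)
    (W : WeierstrassCurve ℚ) [W.IsElliptic] (C : VariableChange ℚ) (hC : C • W = cm7.quadraticTwist (d : ℚ)) (hK : IsImaginaryQuadratic K)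
    (v vbar : HeightOneSpectrum (𝓞 K)) (hv : ((2 : ℕ) : 𝓞 K) ∈ v.asIdeal) (hvbar : ((2 : ℕ) : 𝓞 K) ∈ vbar.asIdeal) (hne : vbar ≠ v)
    (π : (W.baseChange K).endRing) (hrel : (π : AddMonoid.End (W.baseChange K).geomPoints) * π = π - 2) {r : ℤ_[2]} (hr : r * r = r - 2)
    (hpin : ∀ τ ∈ GreenbergSelmer.inertia v, ∀ x : ↥((W.baseChange K).endEigenPrimaryTorsion 2 π r), τ • x = x ∨ τ • x = -x)
    (κ' : ZpExtension K 2) (hκ' : κ'.IsUnramifiedOutside vbar) :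
    ∃ τ₀ ∈ GreenbergSelmer.inertia vbar, τ₀ ∈ κ'.kerSubgroup ∧ ∀ x : ↥((W.baseChange K).endEigenPrimaryTorsion 2 π r), τ₀ • x = -x := by
  haveI : Fact (Nat.Prime 2) := ⟨Nat.prime_two⟩
  have hj : W.j = -3375 := j_eq_of_smul_eq_cm7Twist hd0 W C hC
  obtain ⟨θ, hθ⟩ := exists_sq_eq_neg_seven_of_cmEndo_mem_endRing W K hj π hrel
  have hK2 : Module.finrank ℚ K = 2 := hK.1
  -- the kernel-type clause (R) at `v̄` and the named local type
  obtain ⟨hcl', -⟩ := endEigenPrimaryTorsion_two_pinningClause_swap W K hj hK hθ π hrel hr hv hvbar hne hpin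
  have hcl'' : ∀ τ ∈ GreenbergSelmer.inertia vbar, ∀ y ∈ (W.baseChange K).endEigenPrimaryTorsion 2 π (1 - r),
      τ • y = y ∨ τ • y = -y := fun τ hτ y hy ↦ by
    rcases hcl' τ hτ ⟨y, hy⟩ with h | h
    · exact Or.inl (congrArg Subtype.val h)
    · exact Or.inr (congrArg Subtype.val h)
  have h1r : (1 - r) * (1 - r) = (1 - r) - 2 := by linear_combination hr
  have hdQ : (d : ℚ) ≠ 0 := by exact_mod_cast hd0
  obtain ⟨α, hα, -, hUR⟩ := endEigenPrimaryTorsion_two_localTypes_named_of_pinned W K hj hθ π hrel h1r hdQ C hC vbar hvbar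
    (inertiaDeg_eq_one_of_ne_two K hK2 hvbar hv hne.symm) hcl''
  simp only [sub_sub_cancel] at hUR
  have HR := fun σ n hσ s hs ↦ (hUR σ n hσ s hs).2
  -- `d = 2d'`, `d' ≡ 1 (mod 4)`
  obtain ⟨d', rfl⟩ := h2d
  have hd'1 : d' % 4 = 1 := by omega
  -- the inertia element with `ε = −1`
  have hum1 : IsUnit ((-1 : ℤ) : ℤ_[2]) := by rw [Int.cast_neg, Int.cast_one]; exact isUnit_one.neg
  obtain ⟨τ, hτI, hτχ⟩ := ZpExtension.exists_mem_inertia_cyclotomicCharacter_eq_of_split hK2 hv hvbar hne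
    (adicCompletionPrime_mem_primesAbove K vbar) hum1.unit
  rw [inertia_adicCompletionPrime_eq_map_absInertia K vbar, Subgroup.mem_map] at hτI
  obtain ⟨στ, hστI, hσττ⟩ := hτI
  have hε : ((GaloisRep.cyclotomicCharacter K 2 (absGaloisRestrict K (vbar.adicCompletion K) στ) : ℤ_[2]ˣ) : ℤ_[2]) = -1 := by
    have h := congrArg (fun u : ℤ_[2]ˣ ↦ (u : ℤ_[2])) hτχ
    simp only [IsUnit.unit_spec, Int.cast_neg, Int.cast_one] at h
    rw [← h]; exact congrArg (fun g ↦ ((GaloisRep.cyclotomicCharacter K 2 g : ℤ_[2]ˣ) : ℤ_[2])) hσττ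
  have hτ0 : IsFrobPow στ ((0 : ℕ) : ℤ) := by exact_mod_cast isFrobPow_zero_iff_mem_absInertia.mpr hστI
  -- signs: `ι√2` fixed (`ε ≡ 7 (8)`), `√d'` fixed (U1), so `ι√d` fixed
  have hX : absGaloisRestrict K (vbar.adicCompletion K) στ • absClosureEmbedding ℚ K (WeierstrassCurve.geomSqrt (2 : ℚ)) =
      ((1 : ℤ) : AlgebraicClosure K) * absClosureEmbedding ℚ K (WeierstrassCurve.geomSqrt (2 : ℚ)) := by
    rw [Int.cast_one, one_mul]
    refine (smul_geomSqrt_two_eq_of_cyclotomicCharacter K _).1 (Or.inr ?_)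
    rw [hε, map_neg, map_one]
    decide
  have hY : absGaloisRestrict K (vbar.adicCompletion K) στ • WeierstrassCurve.geomSqrt ((d' : ℤ) : K) =
      ((1 : ℤ) : AlgebraicClosure K) * WeierstrassCurve.geomSqrt ((d' : ℤ) : K) := by
    rw [Int.cast_one, one_mul]
    exact smul_geomSqrt_eq_of_mem_absInertia_of_emod_four_eq_one vbar hvbar hd'1 hστI
  have hXY : (absClosureEmbedding ℚ K (WeierstrassCurve.geomSqrt (2 : ℚ)) * WeierstrassCurve.geomSqrt ((d' : ℤ) : K)) ^ 2 =
      absClosureEmbedding ℚ K (WeierstrassCurve.geomSqrt ((2 * d' : ℤ) : ℚ)) ^ 2 := by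
    rw [mul_pow, ← map_pow, ← map_pow, WeierstrassCurve.geomSqrt_sq, WeierstrassCurve.geomSqrt_sq, WeierstrassCurve.geomSqrt_sq,
      AlgHom.commutes, AlgHom.commutes]
    simp only [map_intCast, map_ofNat, map_mul, Int.cast_mul, Int.cast_ofNat]
  have hA := smul_eq_intCast_mul_of_sq_eq _ hXY hX hY
  rw [show ((1 * 1 : ℤ) : AlgebraicClosure K) = 1 by norm_num, one_mul] at hA
  -- `res τ` acts as `−1` on all of `W*`
  have hneg : ∀ x : ↥((W.baseChange K).endEigenPrimaryTorsion 2 π r), absGaloisRestrict K (vbar.adicCompletion K) στ • x = -x := by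
    intro x
    obtain ⟨k, hk⟩ := (AddCommGroup.mem_primaryComponent).mp (x : (W.baseChange K).geomPrimaryTorsion 2).2
    have hxk : 2 ^ k • (x : (W.baseChange K).geomPrimaryTorsion 2) = 0 :=
      Subtype.ext (by rw [AddSubmonoidClass.coe_nsmul, ZeroMemClass.coe_zero]; exact hk)
    have hmem : (((-1 : ℤ) : ℤ_[2]) - (1 : ℤ) * ((GaloisRep.cyclotomicCharacter K 2 (absGaloisRestrict K (vbar.adicCompletion K) στ) * (α⁻¹) ^ 0 :
        ℤ_[2]ˣ) : ℤ_[2])) ∈ (Ideal.span {(2 : ℤ_[2]) ^ k} : Ideal ℤ_[2]) := by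
      rw [pow_zero, mul_one, hε]; simp
    have h := HR στ 0 hτ0 1 (Or.inl ⟨by exact_mod_cast hA, rfl⟩) k x x.2 hxk (-1) hmem
    exact Subtype.ext (by rw [neg_one_zsmul] at h; exact h)
  refine ⟨absGaloisRestrict K (vbar.adicCompletion K) στ, ⟨στ, hστI, rfl⟩, ?_, hneg⟩
  exact (mem_kerSubgroup_iff_smul_of_frame hd0 W C hC hK v vbar hv hvbar hne π hrel hr hpin κ' hκ' _).mpr (Or.inr hneg)

/-- **`Def(κ', W*, v̄)` is FINITE with at most two elements on the frames with `d ≡ 2, 10 (mod 16)`** (`d = 2d'`, `d' ≡ 1 (mod 4)`): p691098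
`natCard_localDefect_le_two` with the inertial mover above, signs by (C3), one element of order `2` (`eq_of_two_nsmul_eq_zero_endEigenPrimaryTorsion`), and the
ramification of the line at `v̄` (-w5 g4). So the summand of `𝓗` at every place above `v̄` is finite of order `≤ 2` on this class.
[cite: GreenbergLNM1716, §3] [cite: Rubin1999, §3 Lemma 3.6 (ii) and Cor. 3.17] [cite: Agboola2007, §3 Prop. 3.2] -/
theorem finite_localDefect_vbar_of_frame_even_one {d : ℤ} (hd0 : d ≠ 0) (h2d : (2 : ℤ) ∣ d) (hd1 : (d / 2) % 4 = 1)
    (W : WeierstrassCurve ℚ) [W.IsElliptic] (C : VariableChange ℚ) (hC : C • W = cm7.quadraticTwist (d : ℚ)) (hK : IsImaginaryQuadratic K)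
    (v vbar : HeightOneSpectrum (𝓞 K)) (hv : ((2 : ℕ) : 𝓞 K) ∈ v.asIdeal) (hvbar : ((2 : ℕ) : 𝓞 K) ∈ vbar.asIdeal) (hne : vbar ≠ v)
    (π : (W.baseChange K).endRing) (hrel : (π : AddMonoid.End (W.baseChange K).geomPoints) * π = π - 2) {r : ℤ_[2]} (hr : r * r = r - 2)
    (hpin : ∀ τ ∈ GreenbergSelmer.inertia v, ∀ x : ↥((W.baseChange K).endEigenPrimaryTorsion 2 π r), τ • x = x ∨ τ • x = -x)
    (κ' : ZpExtension K 2) (hκ' : κ'.IsUnramifiedOutside vbar) :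
    Finite (resOfLe ↥((W.baseChange K).endEigenPrimaryTorsion 2 π r)
        (inf_le_inf_left κ'.kerSubgroup (GreenbergSelmer.inertia_le_decomp vbar) :
          κ'.kerSubgroup ⊓ GreenbergSelmer.inertia vbar ≤ κ'.kerSubgroup ⊓ GreenbergSelmer.decomp vbar)).ker ∧
      Nat.card (resOfLe ↥((W.baseChange K).endEigenPrimaryTorsion 2 π r)
        (inf_le_inf_left κ'.kerSubgroup (GreenbergSelmer.inertia_le_decomp vbar) :
          κ'.kerSubgroup ⊓ GreenbergSelmer.inertia vbar ≤ κ'.kerSubgroup ⊓ GreenbergSelmer.decomp vbar)).ker ≤ 2 := by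
  haveI : Fact (Nat.Prime 2) := ⟨Nat.prime_two⟩
  have hj : W.j = -3375 := j_eq_of_smul_eq_cm7Twist hd0 W C hC
  obtain ⟨θ, hθ⟩ := exists_sq_eq_neg_seven_of_cmEndo_mem_endRing W K hj π hrel
  have hram : ¬ GreenbergSelmer.inertia vbar ≤ κ'.kerSubgroup := by
    have h := inertia_not_le_kerSubgroup_of_isUnramifiedOutside (p := 2) hK hκ' (adicCompletionPrime_mem_primesAbove K vbar)
    rwa [inertia_adicCompletionPrime_eq_map_absInertia K vbar] at h
  obtain ⟨τ₀, hτI, hτκ, hτ₀⟩ := exists_inertial_mover_vbar_of_frame hd0 h2d hd1 W C hC hK v vbar hv hvbar hne π hrel hr hpin κ' hκ'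
  exact natCard_localDefect_le_two κ' hram (isOpen_stabilizer_endEigenPrimaryTorsion _ 2 π r)
    (fun g hg ↦ (mem_kerSubgroup_iff_smul_of_frame hd0 W C hC hK v vbar hv hvbar hne π hrel hr hpin κ' hκ' g).mp hg)
    hτI hτκ hτ₀ (eq_of_two_nsmul_eq_zero_endEigenPrimaryTorsion W hj hθ π hrel hr)

end Summit.BirchSwinnertonDyer.BirchSwinnertonDyer.Theorems.PrintCf2.LineLocallyTrivial

end
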